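import Mathlib
import Summits.Ventures.HodgeRepro2.T5Orientation

/-!
# T5WedgeBookkeeping — the convention bookkeeping of the pairing in (N)

Kernel form of the [P] sentences of `route/T5-SUPPORT-p1.md` §S1.3(ii) and §S1.4 (Tier-5 support for
N0 «sign/orientation of the pairing» and N1 «orientation»; seat p1, B4 owner):

* §S1.3(ii) «every convention that enters the pairing multiplies it by a non-zero constant: reversing the
  orientation of `S` by `−1`; reordering the four 1-forms by the sign of the permutation (the four 1-forms
  anticommute; the two 2-forms `ω_{ab}`, `\overline{ω_{cd}}` commute); rescaling the eigenvectors `e_{i,σ}` by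
  `λ_i ∈ ℂ^×` by `∏ λ_i`; … None of them can create or destroy (N).»
  — `ι_mul_ι_eq_neg` (1-vectors anticommute), `ιMulti_comp_perm` / `ιMulti_comp_perm_ne_zero_iff` (the sign
  of a reordering; it cannot create or destroy a non-zero wedge), `ιMulti_append`, `blockSwap`,
  `sign_blockSwap`, `ιMulti_two_mul_comm` (two decomposable 2-vectors commute), `ιMulti_smul_univ` /
  `ιMulti_smul_univ_ne_zero_iff` (rescaling by `∏ λ_i`), `integral_const_mul_ne_zero_iff`,
  `integral_neg_ne_zero_iff` (a non-zero constant or an orientation reversal in front of the integral).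
* §S1.4 «the integrand at `τ̄₁` is `\overline{ω_{ab}} ∧ ω_{cd} = \overline{ω_{ab} ∧ \overline{ω_{cd}}}` (even-degree
  forms commute), so `∫_S` at `τ̄₁` is the complex conjugate of `∫_S` at `τ₁`: (N) at `τ₁` ⟺ (N) at `τ̄₁`»
  — `det_complexCoordinatesFour_blockSwap` (`dz̄₁ ∧ dz̄₂ ∧ dz₁ ∧ dz₂ = 4 dx₁∧dy₁∧dx₂∧dy₂`, the same coefficient
  as `dz₁ ∧ dz₂ ∧ dz̄₁ ∧ dz̄₂` because the block swap is an even permutation), `conj_coeff_wedge` (the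
  coefficient of `\overline{ω} ∧ ω′` is the conjugate of the coefficient of `ω ∧ \overline{ω′}`),
  `integral_conj_eq` / `integral_conj_ne_zero_iff` (`∫ \overline{h} = \overline{∫ h}`, hence the two periods
  vanish together).

Everything is Mathlib's exterior algebra (`ExteriorAlgebra.ιMulti` is an alternating map) and Bochner
integral; the coordinate model of a (2,0)-form is the one of `T5Orientation.lean` (`complexCoordinatesFour`).
Nothing about the surface `S`, the forms `f_i^*e_i` or (N) itself is formalised.
-/

namespace Summit.Ventures.HodgeRepro2.T5WedgeBookkeeping

open ExteriorAlgebra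

section Exterior

variable {R : Type*} [CommRing R] {M : Type*} [AddCommGroup M] [Module R M]

/-- Two 1-vectors anticommute in the exterior algebra: `ι x ∧ ι y = −(ι y ∧ ι x)`
(the sign of the transposition). -/
theorem ι_mul_ι_eq_neg (x y : M) : ι R x * ι R y = -(ι R y * ι R x) :=
  eq_neg_of_add_eq_zero_left (ι_add_mul_swap x y)

/-- The wedge of an appended family is the product of the two wedges:
`ιMulti (m+n) (v ++ w) = ιMulti m v * ιMulti n w`. -/
theorem ιMulti_append {m n : ℕ} (v : Fin m → M) (w : Fin n → M) :
    ιMulti R (m + n) (Fin.append v w) = ιMulti R m v * ιMulti R n w := by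
  have h : (fun i => ι R (Fin.append v w i)) =
      Fin.append (fun i => ι R (v i)) (fun i => ι R (w i)) := by
    funext i
    refine Fin.addCases (fun i => ?_) (fun i => ?_) i
    · simp only [Fin.append_left]
    · simp only [Fin.append_right]
  rw [ιMulti_apply, ιMulti_apply, ιMulti_apply, h, List.ofFn_fin_append, List.prod_append]

/-- Reordering the vectors of a wedge by a permutation `σ` multiplies the wedge by `sign σ`
(`ExteriorAlgebra.ιMulti` is an alternating map). -/
theorem ιMulti_comp_perm {n : ℕ} (v : Fin n → M) (σ : Equiv.Perm (Fin n)) :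
    ιMulti R n (v ∘ σ) = Equiv.Perm.sign σ • ιMulti R n v :=
  AlternatingMap.map_perm (ιMulti R n) v σ

/-- A reordering cannot create or destroy a non-zero wedge (the sign is a unit). -/
theorem ιMulti_comp_perm_ne_zero_iff {n : ℕ} (v : Fin n → M) (σ : Equiv.Perm (Fin n)) :
    ιMulti R n (v ∘ σ) ≠ 0 ↔ ιMulti R n v ≠ 0 := by
  rw [ιMulti_comp_perm]
  exact not_congr (smul_eq_zero_iff_eq _)

/-- The block swap `(0 2)(1 3)` of `Fin 4`: it carries the family `(w₀, w₁, v₀, v₁)` to `(v₀, v₁, w₀, w₁)`. -/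
def blockSwap : Equiv.Perm (Fin 4) := Equiv.swap 0 2 * Equiv.swap 1 3

/-- The block swap is an even permutation: moving a 2-form past a 2-form costs no sign. -/
theorem sign_blockSwap : Equiv.Perm.sign blockSwap = 1 := by
  rw [blockSwap, Equiv.Perm.sign_mul, Equiv.Perm.sign_swap (by decide), Equiv.Perm.sign_swap (by decide)]
  decide

/-- Precomposing `w ++ v` with the block swap gives `v ++ w` (for families in any type). -/
theorem append_comp_blockSwap {α : Type*} (v w : Fin 2 → α) :
    (Fin.append w v : Fin (2 + 2) → α) ∘ blockSwap = Fin.append v w := by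
  funext i
  fin_cases i <;> rfl

/-- Two decomposable 2-vectors commute: `(v₀ ∧ v₁) ∧ (w₀ ∧ w₁) = (w₀ ∧ w₁) ∧ (v₀ ∧ v₁)`
(the sentence «the two 2-forms `ω_{ab}`, `\overline{ω_{cd}}` commute» / «even-degree forms commute»). -/
theorem ιMulti_two_mul_comm (v w : Fin 2 → M) :
    ιMulti R 2 v * ιMulti R 2 w = ιMulti R 2 w * ιMulti R 2 v := by
  rw [← ιMulti_append, ← ιMulti_append, ← append_comp_blockSwap v w]
  rw [ιMulti_comp_perm (R := R) (Fin.append w v) blockSwap, sign_blockSwap, one_smul]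

/-- Rescaling the `n` vectors by `c i` rescales the wedge by `∏ c i`
(the sentence «rescaling the eigenvectors `e_{i,σ}` by `λ_i` multiplies the pairing by `∏ λ_i`»). -/
theorem ιMulti_smul_univ {n : ℕ} (c : Fin n → R) (v : Fin n → M) :
    ιMulti R n (fun i => c i • v i) = (∏ i, c i) • ιMulti R n v :=
  AlternatingMap.map_smul_univ (ιMulti R n) c v

end Exterior

section Field

variable {K : Type*} [Field K] {M : Type*} [AddCommGroup M] [Module K M]

/-- Over a field, rescaling by non-zero scalars cannot create or destroy a non-zero wedge. -/
theorem ιMulti_smul_univ_ne_zero_iff {n : ℕ} (c : Fin n → K) (v : Fin n → M) :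
    ιMulti K n (fun i => c i • v i) ≠ 0 ↔ (∀ i, c i ≠ 0) ∧ ιMulti K n v ≠ 0 := by
  rw [ιMulti_smul_univ, smul_ne_zero_iff, Finset.prod_ne_zero_iff]
  simp only [Finset.mem_univ, true_implies]

end Field

section Integral

open MeasureTheory

variable {X : Type*} [MeasurableSpace X] {μ : Measure X}

/-- `∫ \overline{h} = \overline{∫ h}` (Mathlib's `integral_conj`): the period at `τ̄₁` is the complex
conjugate of the period at `τ₁`. -/
theorem integral_conj_eq (h : X → ℂ) :
    ∫ x, (starRingEnd ℂ) (h x) ∂μ = (starRingEnd ℂ) (∫ x, h x ∂μ) :=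
  integral_conj

/-- The conjugate period vanishes iff the period vanishes: (N) at `τ₁` ⟺ (N) at `τ̄₁`. -/
theorem integral_conj_ne_zero_iff (h : X → ℂ) :
    (∫ x, (starRingEnd ℂ) (h x) ∂μ) ≠ 0 ↔ (∫ x, h x ∂μ) ≠ 0 := by
  rw [integral_conj]
  exact map_ne_zero (starRingEnd ℂ)

/-- A non-zero constant in front of the integrand (a normalisation of the measure, a rescaling of the
eigenvectors, the sign of a reordering) cannot create or destroy a non-zero period. -/
theorem integral_const_mul_ne_zero_iff {c : ℂ} (hc : c ≠ 0) (h : X → ℂ) :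
    (∫ x, c * h x ∂μ) ≠ 0 ↔ (∫ x, h x ∂μ) ≠ 0 := by
  rw [integral_const_mul]
  exact mul_ne_zero_iff_left hc

/-- Reversing the orientation of `S` (integrating `−h`) cannot create or destroy a non-zero period. -/
theorem integral_neg_ne_zero_iff (h : X → ℂ) :
    (∫ x, -h x ∂μ) ≠ 0 ↔ (∫ x, h x ∂μ) ≠ 0 := by
  rw [integral_neg]
  exact neg_ne_zero

end Integral

section Coordinates

/-- The coefficient of `dz̄₁ ∧ dz̄₂ ∧ dz₁ ∧ dz₂` in `dx₁ ∧ dy₁ ∧ dx₂ ∧ dy₂` is again `4`: the rows of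
`complexCoordinatesFour` (`dz₁, dz₂, dz̄₁, dz̄₂`) are permuted by the even block swap. -/
theorem det_complexCoordinatesFour_blockSwap :
    (complexCoordinatesFour.submatrix blockSwap id).det = 4 := by
  rw [Matrix.det_permute, sign_blockSwap, det_complexCoordinates_four]
  simp

/-- The coefficient of `\overline{ω} ∧ ω′` (for `ω = f dz₁∧dz₂`, `ω′ = g dz₁∧dz₂`) is the complex conjugate of
the coefficient of `ω ∧ \overline{ω′}`: `\overline{ω} ∧ ω′ = \overline{ω ∧ \overline{ω′}}`. -/
theorem conj_coeff_wedge (f g : ℂ) :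
    (starRingEnd ℂ) f * g * (complexCoordinatesFour.submatrix blockSwap id).det =
      (starRingEnd ℂ) (f * (starRingEnd ℂ) g * complexCoordinatesFour.det) := by
  rw [det_complexCoordinatesFour_blockSwap, det_complexCoordinates_four, map_mul, map_mul,
    Complex.conj_conj, map_ofNat]

end Coordinates

end Summit.Ventures.HodgeRepro2.T5WedgeBookkeeping
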